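import Summits.BirchSwinnertonDyer.BirchSwinnertonDyer.Theorems.PrintX9MuPartSpecWitnessDefs
import Literature.NumberTheory.EllipticCurves.CharacterModuleTorsionDivisibleProdProofs
import HarnessLib

/-!
# A `SpecWitness` at `q_m` from S1 (control) and Howard's DISCRETE conclusion `H¹_𝓕(K, A) ≅ 𝒟 ⊕ M ⊕ M`
# (road R1′ of the shared μ-item: S2 = Howard 2004 Thm. 1.6.1 cited, then dualised) — proofs file

Cell `pub/bsd-print-x9`, seat `bsd-line-x9-p1` LEAD g3 (2026-08-28). THEOREMS ONLY; no definition, no named fact, no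
`sorry`; ROUTE-INDEPENDENT (no `Theses` import). Namespace of the shared letters / witness interface
(`Summit.BirchSwinnertonDyer.BirchSwinnertonDyer.Theorems.HeegnerMuPartStabilized`; interface p632362, sibling
`PrintX9MuPartSpecWitnessOfDVRData` p635135 by x9-p1-w2 g4).

WHY. The memo `HOME/p1/S2-CITABLE-Howard161-g3.md` (evidence #23 on stmt-BirchSwinnertonDyer-27077) records that the «S2»
component of the port is a CITE of B. Howard, Compositio Math. 140 (2004), Thm. 1.6.1 (abstract, class-number-free,
image-free). That theorem's conclusion is stated on the DISCRETE side — `H¹_𝓕(K,T)` free of rank one over the DVR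
`R`, `H¹_𝓕(K,A) ≅ 𝒟 ⊕ M ⊕ M` (`𝒟 = Φ/R`), `len M ≤ len(H¹_𝓕(K,T)/R·κ₁)` — while the witness interface
`SpecWitness Λ 𝔖 𝒳 L q_m c` wants a module `Xq` receiving `𝒳/q_m𝒳` (by S1's dual control map `h`) whose torsion is
finite of cardinality `≤ #(H/κ₁)²`. The two sibling constructors of p635135 take `Xq` finitely generated over `S_m`
together with a length bound on `torsion(Xq)`; the natural `Xq` of the port, the Pontryagin dual
`H¹_𝓕(K,A_q)^∨ = Hom(H¹_𝓕(K,A_q), ℚ/ℤ)`, is most easily controlled through its torsion submodule DIRECTLY: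
`torsion((𝒟 ⊕ M ⊕ M)^∨) ≅ M^∨ ⊕ M^∨` with `len M^∨ = len M`
(`Literature.….IwasawaAlgebra.nonempty_torsion_characterModule_linearEquiv_of_howardShape`). This file therefore
provides the constructor with EXACTLY those inputs.

WHAT.
* `nonempty_specWitness_of_torsionEquiv` — as `nonempty_specWitness_of_dvrData_prod` (p635135) but WITHOUT
  `Module.Finite S_m Xq`: the S2 datum is an `S_m`-isomorphism `torsion_{S_m}(Xq) ≅ M' × M'` with `M'` finite and
  `len M' ≤ len(H/S_m·κ₁)`.
* `nonempty_specWitness_of_howardShape` — S2 in Howard's printed shape: an `S_m`-module `𝒜` (:= `H¹_{𝓕_q}(K, A_q)`)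
  with `𝒜 ≅ 𝒟 × (M × M)`, `𝒟` divisible by the non-zero-divisors of `S_m`, `M` finite, `len M ≤ len(H/S_m·κ₁)`, and the
  dual control map `h : 𝒳/q_m𝒳 → 𝒜^∨ = CharacterModule 𝒜` with `#ker h ≤ c`.
HONEST FRAMING: nothing here constructs `f`, `h`, `e`, `𝒜`, `M` (that is the port: carrier (W9), control (S1),
Howard 1.6.1 (cite)); «beyond-print theorem»: no. BSD is not proved by any of this; no summit statement is proved.

References: [Howard2004HeegnerKolyvagin] Thm. 1.6.1 and proof of Thm. 2.2.10 (𝔮 = T^m + p);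
[MastellaZerman2026] Thm. 2.40 (same shape `Φ/𝓡 ⊕ M ⊕ M`).
-/

set_option linter.dupNamespace false
set_option autoImplicit false

noncomputable section

open scoped Classical Pointwise nonZeroDivisors

open Literature Literature.NumberTheory.EllipticCurves WeierstrassCurve

namespace Summit.BirchSwinnertonDyer.BirchSwinnertonDyer.Theorems.HeegnerMuPartStabilized

/-- **A `SpecWitness` at `q_m` from S1 data and an `S_m`-isomorphism `torsion(Xq) ≅ M' × M'`, `M'` finite,
`len M' ≤ len(H/S_m·κ₁)`** (no finite generation of `Xq` required). Conversions: `q_m • H = 0` from the scalar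
tower; `AddCommGroup.torsion Xq = torsion_{S_m} Xq` (`IwasawaAlgebra.mem_addTorsion_iff_mem_torsion`);
`#M' = p^{len M'} ≤ p^{len(H/κ₁)} = #(H/S_m·κ₁) = #(H/Λ·κ₁)` (`IwasawaAlgebra.natCard_le_pow_of_length_le_mul`).
[cite: Howard2004HeegnerKolyvagin, Thm. 1.6.1 and proof of Thm. 2.2.10 (𝔮 = T^m + p)] [cite: MastellaZerman2026, Thm. 2.40] -/
theorem nonempty_specWitness_of_torsionEquiv {p : ℕ} [hp : Fact p.Prime] {m : ℕ} (hm : 1 ≤ m)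
    {S X : Type} [AddCommGroup S] [Module (IwasawaAlgebra p) S] [AddCommGroup X] [Module (IwasawaAlgebra p) X]
    (L : Submodule (IwasawaAlgebra p) S)
    {H Xq : Type} [AddCommGroup H] [Module (IwasawaAlgebra p) H]
    [Module (IwasawaAlgebra p ⧸
      Ideal.span {(PowerSeries.X ^ m + PowerSeries.C (p : ℤ_[p]) : IwasawaAlgebra p)}) H]
    [IsScalarTower (IwasawaAlgebra p) (IwasawaAlgebra p ⧸
      Ideal.span {(PowerSeries.X ^ m + PowerSeries.C (p : ℤ_[p]) : IwasawaAlgebra p)}) H]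
    [AddCommGroup Xq] [Module (IwasawaAlgebra p) Xq]
    [Module (IwasawaAlgebra p ⧸
      Ideal.span {(PowerSeries.X ^ m + PowerSeries.C (p : ℤ_[p]) : IwasawaAlgebra p)}) Xq]
    -- S1: control
    (f : S →ₗ[IwasawaAlgebra p] H) (κ₁ : H) (hL : L.map f ≤ (IwasawaAlgebra p) ∙ κ₁) (c : ℕ)
    (hcoker : Finite (H ⧸ LinearMap.range f)) (hcoker_le : Nat.card (H ⧸ LinearMap.range f) ≤ c)
    (h : (X ⧸ ((Ideal.span {(PowerSeries.X ^ m + PowerSeries.C (p : ℤ_[p]) : IwasawaAlgebra p)} :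
        Ideal (IwasawaAlgebra p)) • (⊤ : Submodule (IwasawaAlgebra p) X))) →ₗ[IwasawaAlgebra p] Xq)
    (hker : Finite (LinearMap.ker h)) (hker_le : Nat.card (LinearMap.ker h) ≤ c)
    -- S2: DVR structure, torsion given by an explicit square
    (e : H ≃ₗ[IwasawaAlgebra p ⧸
      Ideal.span {(PowerSeries.X ^ m + PowerSeries.C (p : ℤ_[p]) : IwasawaAlgebra p)}]
      (IwasawaAlgebra p ⧸ Ideal.span {(PowerSeries.X ^ m + PowerSeries.C (p : ℤ_[p]) : IwasawaAlgebra p)}))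
    (hκ : κ₁ ≠ 0)
    {M' : Type} [AddCommGroup M']
    [Module (IwasawaAlgebra p ⧸
      Ideal.span {(PowerSeries.X ^ m + PowerSeries.C (p : ℤ_[p]) : IwasawaAlgebra p)}) M'] [Finite M']
    (eT : Submodule.torsion (IwasawaAlgebra p ⧸
        Ideal.span {(PowerSeries.X ^ m + PowerSeries.C (p : ℤ_[p]) : IwasawaAlgebra p)}) Xq ≃ₗ[
      IwasawaAlgebra p ⧸ Ideal.span {(PowerSeries.X ^ m + PowerSeries.C (p : ℤ_[p]) : IwasawaAlgebra p)}]
      (M' × M'))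
    (hM' : Module.length (IwasawaAlgebra p ⧸
        Ideal.span {(PowerSeries.X ^ m + PowerSeries.C (p : ℤ_[p]) : IwasawaAlgebra p)}) M' ≤
      Module.length (IwasawaAlgebra p ⧸
        Ideal.span {(PowerSeries.X ^ m + PowerSeries.C (p : ℤ_[p]) : IwasawaAlgebra p)})
        (H ⧸ Submodule.span (IwasawaAlgebra p ⧸
          Ideal.span {(PowerSeries.X ^ m + PowerSeries.C (p : ℤ_[p]) : IwasawaAlgebra p)}) {κ₁})) :
    Nonempty (SpecWitness (IwasawaAlgebra p) S X L
      (PowerSeries.X ^ m + PowerSeries.C (p : ℤ_[p]) : IwasawaAlgebra p) c) := by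
  -- (0) `q_m` kills `H`
  have hsmul : (Ideal.span {(PowerSeries.X ^ m + PowerSeries.C (p : ℤ_[p]) : IwasawaAlgebra p)} :
      Ideal (IwasawaAlgebra p)) • (⊤ : Submodule (IwasawaAlgebra p) H) = ⊥ := by
    rw [Submodule.ideal_span_singleton_smul, eq_bot_iff]
    intro y hy
    obtain ⟨x, -, rfl⟩ := (Submodule.mem_smul_pointwise_iff_exists y _ ⊤).1 hy
    rw [Submodule.mem_bot, ← IsScalarTower.algebraMap_smul (IwasawaAlgebra p ⧸
      Ideal.span {(PowerSeries.X ^ m + PowerSeries.C (p : ℤ_[p]) : IwasawaAlgebra p)}),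
      Ideal.Quotient.algebraMap_eq,
      Ideal.Quotient.eq_zero_iff_mem.mpr (Ideal.mem_span_singleton_self _)]
    exact zero_smul (IwasawaAlgebra p ⧸
      Ideal.span {(PowerSeries.X ^ m + PowerSeries.C (p : ℤ_[p]) : IwasawaAlgebra p)}) x
  -- (1) the `ℤ`-torsion of `Xq` = its `S_m`-torsion ≅ `M' × M'`, finite of cardinality `#M'^2`
  have eT' : (AddCommGroup.torsion Xq) ≃ (Submodule.torsion (IwasawaAlgebra p ⧸
      Ideal.span {(PowerSeries.X ^ m + PowerSeries.C (p : ℤ_[p]) : IwasawaAlgebra p)}) Xq) :=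
    { toFun := fun x => ⟨x.1, (IwasawaAlgebra.mem_addTorsion_iff_mem_torsion p hm x.1).mp x.2⟩
      invFun := fun x => ⟨x.1, (IwasawaAlgebra.mem_addTorsion_iff_mem_torsion p hm x.1).mpr x.2⟩
      left_inv := fun _ => rfl
      right_inv := fun _ => rfl }
  haveI : Finite (M' × M') := inferInstance
  have hfinTors : Finite (AddCommGroup.torsion Xq) := Finite.of_equiv _ (eT'.trans eT.toEquiv).symm
  have hcardTors : Nat.card (AddCommGroup.torsion Xq) = Nat.card M' ^ 2 := by
    rw [Nat.card_congr (eT'.trans eT.toEquiv), Nat.card_prod, sq]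
  -- (2) `H ⧸ S_m∙κ₁` is finite and has the same cardinality as `H ⧸ Λ∙κ₁`
  have hfinQuotS := IwasawaAlgebra.finite_quotient_span_singleton_of_linearEquiv p hm e κ₁ hκ
  have hspan : (Submodule.span (IwasawaAlgebra p ⧸
      Ideal.span {(PowerSeries.X ^ m + PowerSeries.C (p : ℤ_[p]) : IwasawaAlgebra p)}) {κ₁}).restrictScalars
        (IwasawaAlgebra p) = (IwasawaAlgebra p) ∙ κ₁ :=
    Submodule.restrictScalars_span (IwasawaAlgebra p) (IwasawaAlgebra p ⧸
      Ideal.span {(PowerSeries.X ^ m + PowerSeries.C (p : ℤ_[p]) : IwasawaAlgebra p)})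
      Ideal.Quotient.mk_surjective {κ₁}
  have eQ : (H ⧸ ((IwasawaAlgebra p) ∙ κ₁)) ≃ (H ⧸ Submodule.span (IwasawaAlgebra p ⧸
      Ideal.span {(PowerSeries.X ^ m + PowerSeries.C (p : ℤ_[p]) : IwasawaAlgebra p)}) {κ₁}) :=
    ((Submodule.quotEquivOfEq _ _ hspan.symm).trans
      (Submodule.Quotient.restrictScalarsEquiv (IwasawaAlgebra p) _)).toEquiv
  have hfinQuot : Finite (H ⧸ ((IwasawaAlgebra p) ∙ κ₁)) := Finite.of_equiv _ eQ.symm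
  -- (3) `#M' ≤ #(H ⧸ S_m∙κ₁)` from the length bound, hence `#Xq_tors = #M'^2 ≤ #(H/κ₁)^2`
  haveI := hfinQuotS
  have hcardM' : Nat.card M' ≤ Nat.card (H ⧸ ((IwasawaAlgebra p) ∙ κ₁)) := by
    rw [Nat.card_congr eQ]
    have h1 := IwasawaAlgebra.natCard_le_pow_of_length_le_mul p hm (N := M')
      (N' := H ⧸ Submodule.span (IwasawaAlgebra p ⧸
        Ideal.span {(PowerSeries.X ^ m + PowerSeries.C (p : ℤ_[p]) : IwasawaAlgebra p)}) {κ₁}) 1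
      (by rw [Nat.cast_one, one_mul]; exact hM')
    simpa only [pow_one] using h1
  refine ⟨SpecWitness.mk (H := H) (Xq := Xq) (κ₁ := κ₁) (f := f) (h := h) (smul_top_eq_bot := hsmul)
    (map_le := hL) (finite_coker := hcoker) (card_coker_le := hcoker_le) (finite_ker := hker)
    (card_ker_le := hker_le) (finite_torsion := hfinTors) (finite_quot := hfinQuot)
    (card_torsion_le_sq := ?_)⟩
  rw [hcardTors]
  exact Nat.pow_le_pow_left hcardM' 2

/-- **A `SpecWitness` at `q_m` from S1 data and HOWARD'S PRINTED SHAPE `𝒜 ≅ 𝒟 × (M × M)`** (`𝒜` = the discrete Selmer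
group `H¹_{𝓕_q}(K, A_q)`, `𝒟` divisible by the non-zero-divisors of `S_m`, `M` finite with `len M ≤ len(H/S_m·κ₁)`), the dual
control map landing in the Pontryagin dual `𝒜^∨ = CharacterModule 𝒜`: `torsion(𝒜^∨) ≅ M^∨ × M^∨` and `len M^∨ = len M`
by `IwasawaAlgebra.nonempty_torsion_characterModule_linearEquiv_of_howardShape`, then
`nonempty_specWitness_of_torsionEquiv`. [cite: Howard2004HeegnerKolyvagin, Thm. 1.6.1] [cite: MastellaZerman2026, Thm. 2.40] -/
theorem nonempty_specWitness_of_howardShape {p : ℕ} [hp : Fact p.Prime] {m : ℕ} (hm : 1 ≤ m)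
    {S X : Type} [AddCommGroup S] [Module (IwasawaAlgebra p) S] [AddCommGroup X] [Module (IwasawaAlgebra p) X]
    (L : Submodule (IwasawaAlgebra p) S)
    {H 𝒜 : Type} [AddCommGroup H] [Module (IwasawaAlgebra p) H]
    [Module (IwasawaAlgebra p ⧸
      Ideal.span {(PowerSeries.X ^ m + PowerSeries.C (p : ℤ_[p]) : IwasawaAlgebra p)}) H]
    [IsScalarTower (IwasawaAlgebra p) (IwasawaAlgebra p ⧸
      Ideal.span {(PowerSeries.X ^ m + PowerSeries.C (p : ℤ_[p]) : IwasawaAlgebra p)}) H]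
    [AddCommGroup 𝒜] [Module (IwasawaAlgebra p) 𝒜]
    [Module (IwasawaAlgebra p ⧸
      Ideal.span {(PowerSeries.X ^ m + PowerSeries.C (p : ℤ_[p]) : IwasawaAlgebra p)}) 𝒜]
    -- S1: control
    (f : S →ₗ[IwasawaAlgebra p] H) (κ₁ : H) (hL : L.map f ≤ (IwasawaAlgebra p) ∙ κ₁) (c : ℕ)
    (hcoker : Finite (H ⧸ LinearMap.range f)) (hcoker_le : Nat.card (H ⧸ LinearMap.range f) ≤ c)
    (h : (X ⧸ ((Ideal.span {(PowerSeries.X ^ m + PowerSeries.C (p : ℤ_[p]) : IwasawaAlgebra p)} :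
        Ideal (IwasawaAlgebra p)) • (⊤ : Submodule (IwasawaAlgebra p) X))) →ₗ[IwasawaAlgebra p]
        CharacterModule 𝒜)
    (hker : Finite (LinearMap.ker h)) (hker_le : Nat.card (LinearMap.ker h) ≤ c)
    -- S2: Howard Thm 1.6.1's conclusion
    (e : H ≃ₗ[IwasawaAlgebra p ⧸
      Ideal.span {(PowerSeries.X ^ m + PowerSeries.C (p : ℤ_[p]) : IwasawaAlgebra p)}]
      (IwasawaAlgebra p ⧸ Ideal.span {(PowerSeries.X ^ m + PowerSeries.C (p : ℤ_[p]) : IwasawaAlgebra p)}))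
    (hκ : κ₁ ≠ 0)
    {D M : Type} [AddCommGroup D] [AddCommGroup M]
    [Module (IwasawaAlgebra p ⧸
      Ideal.span {(PowerSeries.X ^ m + PowerSeries.C (p : ℤ_[p]) : IwasawaAlgebra p)}) D]
    [Module (IwasawaAlgebra p ⧸
      Ideal.span {(PowerSeries.X ^ m + PowerSeries.C (p : ℤ_[p]) : IwasawaAlgebra p)}) M] [Finite M]
    (e𝒜 : 𝒜 ≃ₗ[IwasawaAlgebra p ⧸
      Ideal.span {(PowerSeries.X ^ m + PowerSeries.C (p : ℤ_[p]) : IwasawaAlgebra p)}] D × (M × M))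
    (hD : ∀ r : (IwasawaAlgebra p ⧸
        Ideal.span {(PowerSeries.X ^ m + PowerSeries.C (p : ℤ_[p]) : IwasawaAlgebra p)})⁰,
      ∀ d : D, ∃ d' : D, (r : IwasawaAlgebra p ⧸
        Ideal.span {(PowerSeries.X ^ m + PowerSeries.C (p : ℤ_[p]) : IwasawaAlgebra p)}) • d' = d)
    (hM : Module.length (IwasawaAlgebra p ⧸
        Ideal.span {(PowerSeries.X ^ m + PowerSeries.C (p : ℤ_[p]) : IwasawaAlgebra p)}) M ≤
      Module.length (IwasawaAlgebra p ⧸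
        Ideal.span {(PowerSeries.X ^ m + PowerSeries.C (p : ℤ_[p]) : IwasawaAlgebra p)})
        (H ⧸ Submodule.span (IwasawaAlgebra p ⧸
          Ideal.span {(PowerSeries.X ^ m + PowerSeries.C (p : ℤ_[p]) : IwasawaAlgebra p)}) {κ₁})) :
    Nonempty (SpecWitness (IwasawaAlgebra p) S X L
      (PowerSeries.X ^ m + PowerSeries.C (p : ℤ_[p]) : IwasawaAlgebra p) c) := by
  obtain ⟨⟨eT⟩, hfin, hlen⟩ :=
    IwasawaAlgebra.nonempty_torsion_characterModule_linearEquiv_of_howardShape p hm e𝒜 hD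
  haveI := hfin
  exact nonempty_specWitness_of_torsionEquiv hm L f κ₁ hL c hcoker hcoker_le h hker hker_le e hκ eT
    (hlen ▸ hM)

end Summit.BirchSwinnertonDyer.BirchSwinnertonDyer.Theorems.HeegnerMuPartStabilized

end
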